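import Summits.RiemannHypothesis.RiemannHypothesis.Theorems.SuzukiSharpRadiusXiAtOne
import Literature.NumberTheory.LFunctions.SuzukiSingleOperatorKernelProofs
import Literature.NumberTheory.LFunctions.SuzukiSmallWindows

/-!
# SuzukiSharpRadius — the saddle/height bound on a fixed line, the window mechanism, and the reduction of the SHARP
linear clean radius to the one-line minimum of `Re ξ'/ξ` (column DBR; RH-FREE)

RH-FREE throughout; nothing here bears on the truth of RH (a clean window certifies nothing about RH; the residual
`Theses.SuzukiWindowsDoor.AllWindowsWitness` — ONE `θ` with ALL windows clean — is RH by
`Theorems.SuzukiWindowsDoorConverse.allWindows_iff_riemannHypothesis` and is not touched).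

Second proof file of the cell rh-dbr's theory target T-LCR⋆ (`Theorems.SuzukiSharpRadiusDefs`; S1 in
`Theorems.SuzukiSharpRadiusXiAtOne`).  PROVED HERE:
* §1 **S3′, the saddle (imaginary-axis) bound on a FIXED line** (`saddle_height_bound_at`): for `θ₀ > 1`, `b > ½` there is
  `C = C(θ₀,b) ≥ 0` with `|K_θ(x)| ≤ C·exp(b x − 2θ m)` for all `θ ≥ θ₀`, all `m ≤ inf_u Re ξ'/ξ(½+b+iu)`, all `x`:
  line independence (`invFourierLine_limTheta_eq`), `|Θ_θ(u+ib)| = exp(−2θ Re ξ'/ξ(½+b−iu))` EXACTLY (`norm_limTheta`), and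
  `exp(−2θR) ≤ exp(−2θ₀R)·exp(−2(θ−θ₀)m)`; `C = (2π)⁻¹ e^{2θ₀ Re ξ'/ξ(½+b)} ∫|Θ_{θ₀}(u+ib)|du`.
  (The typed `SaddleHeightBound` also asks uniformity in `½ < b ≤ b₁`; not needed below and not proved.)
* §2 **the window mechanism** (`linear_clean_radius_of_line_min`): if on ONE line `Re s = σ > 1` the minimum over `u` of
  `Re ξ'/ξ(σ+iu)` is at `u = 0`, then EVERY `c < ξ'/ξ(σ)/(σ − ½)` is a linear clean radius
  (`∃ θ₁ ∀ θ ≥ θ₁, CleanUpTo θ (cθ)`), by §1 at `b = σ − ½` and the small-window test `noUnitEigenvalue_of_small_window`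
  (`2t · C e^{−2εθ} < 1`, `ε = ξ'/ξ(σ) − cb > 0`).
* §3 **the reduction** (`linearCleanRadiusSharp_of_minOnAxis : XiLogDerivMinOnAxis → LinearCleanRadiusSharp`): continuity of
  `σ ↦ ξ'/ξ(σ)/(σ−½)` at `σ = 1`, where its value is `2ξ'/ξ(1) = c⋆` (S1), picks a line `σ ∈ (1,2]` with `c < ξ'/ξ(σ)/(σ−½)`;
  hence `sharpRadiusReduction : SharpRadiusReduction` (S5, with its first and third hypotheses now theorems) and
  `linearCleanRadius_of_minOnAxis : XiLogDerivMinOnAxis → LinearCleanRadius`.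
What remains NAMED and unproved is exactly S2 `XiLogDerivMinOnAxis` (Hadamard product + finite zero facts).  An
UNCONDITIONAL line (`σ = 8`, explicit formula only) is `Theorems.SuzukiSharpRadiusEight`.

References: [Su20] M. Suzuki, ASPM 84 (2020) 399–411 = arXiv:1907.07302, (1.9), Thm 1.2; [Su21] M. Suzuki,
J. Funct. Anal. 281 (2021) 109116, Prop. 4.2 (small windows).
-/

noncomputable section

-- D-0017: `Summit.<S>.<S>.…` is the designed namespace of a single-problem summit.
set_option linter.dupNamespace false

open Complex MeasureTheory Filter Topology Set

namespace Summit.RiemannHypothesis.RiemannHypothesis.Theorems.SuzukiSharpRadius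

open Literature.NumberTheory.LFunctions
open Summit.RiemannHypothesis.RiemannHypothesis.Theorems.SuzukiCleanRadius

/-! ## §1 The saddle bound on a fixed line `Im z = b`, `b > ½` -/

/-- The point of the critical-line parametrisation: `½ − i(u + ib) = (½ + b) + (−u)i`. -/
theorem half_sub_I_mul_line (u b : ℝ) :
    (1 : ℂ) / 2 - I * ((u : ℂ) + (b : ℂ) * I) = (((1 / 2 + b : ℝ)) : ℂ) + ((-u : ℝ) : ℂ) * I := by
  apply Complex.ext <;> simp

/-- `xiLogDerivRe σ u = Re (logDeriv ξ)(σ + iu)`. -/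
theorem xiLogDerivRe_eq_logDeriv (σ u : ℝ) :
    xiLogDerivRe σ u = (logDeriv riemannXi ((σ : ℂ) + (u : ℂ) * I)).re := by
  rw [logDeriv_apply]; rfl

/-- On the line `Im z = b`: `|Θ_θ(u + ib)| = exp(−2θ · Re ξ'/ξ((½+b) − iu))` EXACTLY. -/
theorem norm_limTheta_line_eq (θ u b : ℝ) :
    ‖limTheta θ ((u : ℂ) + (b : ℂ) * I)‖ = Real.exp (-2 * θ * xiLogDerivRe (1 / 2 + b) (-u)) := by
  rw [norm_limTheta, half_sub_I_mul_line, xiLogDerivRe_eq_logDeriv]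

/-- Pointwise comparison of the symbols of orders `θ ≥ θ₀` on a line where `Re ξ'/ξ ≥ m`:
`|Θ_θ(u+ib)| ≤ exp(−2(θ−θ₀)m) · |Θ_{θ₀}(u+ib)|`. -/
theorem norm_limTheta_line_le_of_le {θ₀ θ b m : ℝ} (hθ : θ₀ ≤ θ)
    (hm : ∀ u : ℝ, m ≤ xiLogDerivRe (1 / 2 + b) u) (u : ℝ) :
    ‖limTheta θ ((u : ℂ) + (b : ℂ) * I)‖ ≤
      Real.exp (-2 * (θ - θ₀) * m) * ‖limTheta θ₀ ((u : ℂ) + (b : ℂ) * I)‖ := by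
  rw [norm_limTheta_line_eq, norm_limTheta_line_eq, ← Real.exp_add, Real.exp_le_exp]
  have h := hm (-u)
  have hθ' : 0 ≤ θ - θ₀ := by linarith
  nlinarith [mul_le_mul_of_nonneg_left h hθ']

/-- **S3′ — the saddle/height bound on a fixed line** (RH-FREE): for `θ₀ > 1` and `b > ½` there is `C ≥ 0` such that for
all `θ ≥ θ₀`, all `m` with `m ≤ Re ξ'/ξ(½+b+iu)` for every `u`, and all real `x`, `|K_θ(x)| ≤ C · exp(b·x − 2θ·m)`. -/
theorem saddle_height_bound_at {θ₀ : ℝ} (hθ₀ : 1 < θ₀) {b : ℝ} (hb : 1 / 2 < b) :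
    ∃ C : ℝ, 0 ≤ C ∧ ∀ θ : ℝ, θ₀ ≤ θ → ∀ m : ℝ, (∀ u : ℝ, m ≤ xiLogDerivRe (1 / 2 + b) u) →
      ∀ x : ℝ, |limKernel θ x| ≤ C * Real.exp (b * x - 2 * θ * m) := by
  set Iθ₀ : ℝ := ∫ u : ℝ, ‖limTheta θ₀ ((u : ℂ) + (b : ℂ) * I)‖ with hI
  have hI0 : 0 ≤ Iθ₀ := integral_nonneg fun u => norm_nonneg _
  set R0 : ℝ := xiLogDerivRe (1 / 2 + b) 0 with hR0
  refine ⟨1 / (2 * Real.pi) * Real.exp (2 * θ₀ * R0) * Iθ₀, by positivity, fun θ hθ m hm x => ?_⟩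
  have hθ1 : 1 < θ := lt_of_lt_of_le hθ₀ hθ
  have hmR0 : m ≤ R0 := hm 0
  -- the integral of the symbol of order θ against that of order θ₀
  have hint : ∫ u : ℝ, ‖limTheta θ ((u : ℂ) + (b : ℂ) * I)‖ ≤ Real.exp (-2 * (θ - θ₀) * m) * Iθ₀ := by
    rw [hI, ← integral_const_mul]
    refine integral_mono_of_nonneg (Eventually.of_forall fun u => norm_nonneg _)
      (((integrable_limTheta_line hθ₀ hb).norm).const_mul _) (Eventually.of_forall fun u => ?_)
    exact norm_limTheta_line_le_of_le hθ hm u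
  have hexp : Real.exp (-2 * (θ - θ₀) * m) ≤ Real.exp (2 * θ₀ * R0) * Real.exp (-(2 * θ * m)) := by
    rw [← Real.exp_add, Real.exp_le_exp]
    nlinarith
  calc |limKernel θ x| = |(invFourierLine (limTheta θ) 1 x).re| := rfl
    _ ≤ ‖invFourierLine (limTheta θ) 1 x‖ := Complex.abs_re_le_norm _
    _ = ‖invFourierLine (limTheta θ) b x‖ := by rw [invFourierLine_limTheta_eq hθ1 (by norm_num) hb]
    _ ≤ 1 / (2 * Real.pi) * Real.exp (b * x) * ∫ u : ℝ, ‖limTheta θ ((u : ℂ) + (b : ℂ) * I)‖ :=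
        norm_invFourierLine_le _ _ _
    _ ≤ 1 / (2 * Real.pi) * Real.exp (b * x) * (Real.exp (-2 * (θ - θ₀) * m) * Iθ₀) := by gcongr
    _ ≤ 1 / (2 * Real.pi) * Real.exp (b * x) * (Real.exp (2 * θ₀ * R0) * Real.exp (-(2 * θ * m)) * Iθ₀) := by
        gcongr
    _ = 1 / (2 * Real.pi) * Real.exp (2 * θ₀ * R0) * Iθ₀ * Real.exp (b * x - 2 * θ * m) := by
        rw [sub_eq_add_neg, Real.exp_add]; ring

/-! ## §2 The window mechanism: a one-line minimum gives a linear clean radius -/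

/-- For `ε > 0`, `A ≥ 0` and `θ ≥ A/ε² + 1` (so `θ > 0`): `A · θ · e^{−2εθ} < 1` (from `e^{y} ≥ 1 + y + y²/2`). -/
theorem mul_mul_exp_neg_lt_one {ε A θ : ℝ} (hε : 0 < ε) (hA : 0 ≤ A) (hθ : A / ε ^ 2 + 1 ≤ θ) :
    A * θ * Real.exp (-(2 * ε * θ)) < 1 := by
  have hθ0 : 0 < θ := by
    have : 0 ≤ A / ε ^ 2 := by positivity
    linarith
  have hq := Real.quadratic_le_exp_of_nonneg (by positivity : (0 : ℝ) ≤ 2 * ε * θ)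
  have hpos : 0 < Real.exp (2 * ε * θ) := Real.exp_pos _
  rw [Real.exp_neg, ← div_eq_mul_inv, div_lt_one hpos]
  have h1 : A * θ < 2 * ε ^ 2 * θ ^ 2 := by
    have hε2 : 0 < ε ^ 2 := by positivity
    have : A ≤ ε ^ 2 * (θ - 1) := by
      have := mul_le_mul_of_nonneg_left hθ hε2.le
      have e : ε ^ 2 * (A / ε ^ 2 + 1) = A + ε ^ 2 := by field_simp
      nlinarith
    nlinarith
  nlinarith

/-- **The window mechanism** (RH-FREE): if on the line `Re s = σ`, `σ > 1`, the minimum over `u` of `Re ξ'/ξ(σ+iu)` is attained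
at `u = 0`, then every `c < ξ'/ξ(σ)/(σ − ½)` is a linear clean radius: there is `θ₁` such that for all `θ ≥ θ₁` every window
`0 ≤ t ≤ cθ` of `𝖪_θ` carries no eigenvalue `±1`.  (§1 at `b = σ − ½`, `m = ξ'/ξ(σ)`: on `|u| < 2t ≤ 2cθ`,
`|K_θ(u)| ≤ C e^{−2εθ}` with `ε = m − cb > 0`, and `2cθ · C e^{−2εθ} < 1` for large `θ`.) -/
theorem linear_clean_radius_of_line_min {σ : ℝ} (hσ : 1 < σ)
    (hmin : ∀ u : ℝ, xiLogDerivRe σ 0 ≤ xiLogDerivRe σ u) :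
    ∀ c : ℝ, c < xiLogDerivRe σ 0 / (σ - 1 / 2) → ∃ θ₁ : ℝ, ∀ θ : ℝ, θ₁ ≤ θ → CleanUpTo θ (c * θ) := by
  intro c hc
  set b : ℝ := σ - 1 / 2 with hbdef
  set m : ℝ := xiLogDerivRe σ 0 with hmdef
  have hb : 1 / 2 < b := by rw [hbdef]; linarith
  have hb0 : 0 < b := by linarith
  have hσb : 1 / 2 + b = σ := by rw [hbdef]; ring
  have hcb : c * b < m := by rwa [lt_div_iff₀ hb0] at hc
  set ε : ℝ := m - c * b with hεdef
  have hε : 0 < ε := by rw [hεdef]; linarith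
  obtain ⟨C, hC0, hC⟩ := saddle_height_bound_at (θ₀ := 2) (by norm_num) hb
  have hm' : ∀ u : ℝ, m ≤ xiLogDerivRe (1 / 2 + b) u := fun u => by rw [hσb]; exact hmin u
  set A : ℝ := 2 * max c 0 * C with hAdef
  have hA0 : 0 ≤ A := by positivity
  refine ⟨max 2 (A / ε ^ 2 + 1), fun θ hθ t ht0 htc => ?_⟩
  have hθ2 : 2 ≤ θ := le_trans (le_max_left _ _) hθ
  have hθ0 : 0 < θ := by linarith
  have hθA : A / ε ^ 2 + 1 ≤ θ := le_trans (le_max_right _ _) hθ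
  -- the uniform bound on the doubled window
  have hK : ∀ u : ℝ, |u| < 2 * t → |limKernel θ u| ≤ C * Real.exp (-(2 * ε * θ)) := by
    intro u hu
    have hu' : u < 2 * t := (abs_lt.1 hu).2
    have h1 := hC θ hθ2 m hm' u
    refine h1.trans (mul_le_mul_of_nonneg_left (Real.exp_le_exp.2 ?_) hC0)
    -- `b u − 2θm ≤ 2bcθ − 2θm = −2εθ`
    have : b * u ≤ b * (2 * (c * θ)) := mul_le_mul_of_nonneg_left (by linarith) hb0.le
    rw [hεdef]; nlinarith
  refine noUnitEigenvalue_of_small_window hK ?_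
  -- `2t · C e^{−2εθ} ≤ A θ e^{−2εθ} < 1`
  have hc0 : c ≤ max c 0 := le_max_left _ _
  have ht : 2 * t ≤ 2 * max c 0 * θ := by nlinarith [le_max_right c 0]
  have hlt := mul_mul_exp_neg_lt_one hε hA0 hθA
  have hpos : 0 ≤ C * Real.exp (-(2 * ε * θ)) := by positivity
  calc 2 * t * (C * Real.exp (-(2 * ε * θ))) ≤ 2 * max c 0 * θ * (C * Real.exp (-(2 * ε * θ))) :=
        mul_le_mul_of_nonneg_right ht hpos
    _ = A * θ * Real.exp (-(2 * ε * θ)) := by rw [hAdef]; ring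
    _ < 1 := hlt

/-! ## §3 The reduction of the sharp radius to the one-line minimum near `σ = 1` -/

/-- `σ ↦ Re ξ'/ξ(σ)` is continuous at `σ = 1` (`ξ` entire, `ξ(1) = ½ ≠ 0`). -/
theorem continuousAt_xiLogDerivRe_one : ContinuousAt (fun σ : ℝ => xiLogDerivRe σ 0) 1 := by
  have hopen : IsOpen {s : ℂ | riemannXi s ≠ 0} :=
    isOpen_ne_fun differentiable_riemannXi.continuous continuous_const
  have h1 : riemannXi ((1 : ℝ) : ℂ) ≠ 0 := by
    rw [Complex.ofReal_one, riemannXi_one]; norm_num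
  have hc : ContinuousAt (logDeriv riemannXi) ((1 : ℝ) : ℂ) :=
    (continuousOn_logDeriv_riemannXi.continuousAt (hopen.mem_nhds h1))
  have hc2 : ContinuousAt (fun σ : ℝ => (logDeriv riemannXi (σ : ℂ)).re) 1 :=
    Complex.continuous_re.continuousAt.comp (hc.comp Complex.continuous_ofReal.continuousAt)
  refine hc2.congr (Eventually.of_forall fun σ => ?_)
  simp only [xiLogDerivRe_eq_logDeriv, Complex.ofReal_zero, zero_mul, add_zero]

/-- **The reduction** (RH-FREE): the one-line minimum S2 (`XiLogDerivMinOnAxis`, on `1 < σ ≤ 2`) implies the SHARP linear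
clean radius `LinearCleanRadiusSharp` — for `c < c⋆ = 2ξ'/ξ(1)` (S1), continuity of `σ ↦ ξ'/ξ(σ)/(σ − ½)` at `σ = 1` picks
`σ ∈ (1,2]` with `c < ξ'/ξ(σ)/(σ−½)`, and §2 applies on that line. -/
theorem linearCleanRadiusSharp_of_minOnAxis (hmin : XiLogDerivMinOnAxis) : LinearCleanRadiusSharp := by
  intro c hc
  rw [sharpCleanConst_eq_two_mul] at hc
  -- g(σ) = ξ'/ξ(σ)/(σ − ½) is continuous at 1 with value 2 ξ'/ξ(1) > c
  have hg : ContinuousAt (fun σ : ℝ => xiLogDerivRe σ 0 / (σ - 1 / 2)) 1 :=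
    continuousAt_xiLogDerivRe_one.div ((continuous_id.sub continuous_const).continuousAt) (by norm_num)
  have hg1 : c < (fun σ : ℝ => xiLogDerivRe σ 0 / (σ - 1 / 2)) 1 := by
    show c < xiLogDerivRe 1 0 / (1 - 1 / 2)
    rw [show (1 : ℝ) - 1 / 2 = 1 / 2 by norm_num, div_eq_mul_inv, show ((1 : ℝ) / 2)⁻¹ = 2 by norm_num]
    linarith
  have hev : ∀ᶠ σ : ℝ in 𝓝 1, c < xiLogDerivRe σ 0 / (σ - 1 / 2) := hg.eventually (eventually_gt_nhds hg1)
  -- points `σ > 1` close to `1`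
  have hev' : ∀ᶠ σ : ℝ in 𝓝[>] 1, c < xiLogDerivRe σ 0 / (σ - 1 / 2) := hev.filter_mono nhdsWithin_le_nhds
  have hev2 : ∀ᶠ σ : ℝ in 𝓝[>] 1, σ ≤ 2 := by
    have : Ioo (1 : ℝ) 2 ∈ 𝓝[>] (1 : ℝ) := Ioo_mem_nhdsGT (by norm_num)
    filter_upwards [this] with σ hσ using hσ.2.le
  have hev3 : ∀ᶠ σ : ℝ in 𝓝[>] 1, σ ∈ Ioi (1 : ℝ) := eventually_mem_nhdsWithin
  obtain ⟨σ, hcσ, hσ2, hσ1⟩ := (hev'.and (hev2.and hev3)).exists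
  rw [mem_Ioi] at hσ1
  exact linear_clean_radius_of_line_min hσ1 (fun u => hmin σ u hσ1 hσ2) c hcσ

/-- **S5 `SharpRadiusReduction`, PROVED** (RH-FREE) — in fact only its middle hypothesis S2 is used: S3′ (§1) and S1
(`Theorems.SuzukiSharpRadiusXiAtOne`) are theorems. -/
theorem sharpRadiusReduction : SharpRadiusReduction := fun _ hmin _ =>
  linearCleanRadiusSharp_of_minOnAxis hmin

/-- RH-FREE corollary: S2 alone implies the landed `LinearCleanRadius` with every `c < c⋆` (S6 + `0 < c⋆`). -/
theorem linearCleanRadius_of_minOnAxis (hmin : XiLogDerivMinOnAxis) : LinearCleanRadius :=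
  linearCleanRadius_of_sharp (linearCleanRadiusSharp_of_minOnAxis hmin)

end Summit.RiemannHypothesis.RiemannHypothesis.Theorems.SuzukiSharpRadius

end
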